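import Mathlib
import Summits.NavierStokesRegularity.FluidComputer.CertifierApproxInverse

/-!
# Exact inverses FROM APPROXIMATE-INVERSE DATA, part 2: the bordered head (3-B-nested eigenpair
# rows) — `Binv` and its six matrix hypotheses from the certifiers' `X̃`, `θ`, `δ_X`
(profile-cert-3 g7, cell `ns-blowup`, 2026-08-27)

HONEST FRAMING (human rulings D-0035/D-0074): nothing here is a claim about Navier–Stokes
blow-up. WHAT THIS IS NOT: not NS evidence. MODEL lane bookkeeping about the FORMAT of the F5
certificates of GROUP B (`CertificateAbcSpectrum*` eigenpair rows). No certificate, number or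
census word is moved. Sequel of `CertifierApproxInverse` (§1 abstract front-end, §2 `ℓ²`
bookkeeping, §3 unbordered head).

§4 `exists_borderedInverse_of_approx`: on the BORDERED coordinate space `(K → 𝕜) × 𝕜` with the
`ℓ²`-product norm, from the float-inverse data of the 3-B-nested certifiers (cert3.py `run_row`
steps 7–12: `θ ≥ ‖I − X̃Â₀‖₂`, `‖X̃‖ ≤ nX`, `‖X̃[−B·; 0]‖ ≤ yB`, `‖B‖ ≤ nB`, `‖C (X̃·)₁‖ ≤ yC`,
`‖C‖ ≤ nC`, the `μ`-row `‖(X̃·)₂‖ ≤ xmu`, `‖(X̃[B·; 0])₂‖ ≤ ygB`, tail mass `‖ṽ_t‖ ≤ nt`, shell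
constant `MU2X` for `X̃`'s block) a linear `Binv` satisfying EXACTLY the six matrix hypotheses
`hBinv / hαM / hβBM / hβCM / hgBM / hshellM` of
`BorderedEigenpairFromSections.certified_eigenpair_of_sections_nested` (p465285) with
`α = nX/(1−θ)`, `δ = αθ`, `β_B = yB + nB δ`, `β_C' = yC + nC δ + nt (xmu + δ)`, `g_B = ygB + nB δ`,
`MU2 = MU2X − nB nC δ` — cert3.py docstring l.8–16 literally (impl-1 (c4)/(N3)–(N5) and impl-2
have the same shape). Generic in the first-order matrix `a`, the diagonal `dg`, the border `ṽ`,
the shell weights `w`. Mathlib + part 1; no new definitions. bears_on LADDER-NS N5 / Z4-a(1)(2)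
(F5 chain rigour, caveat (i) «outward rounding / certifier audit»). [folklore] throughout.
-/

noncomputable section

namespace Summit.NavierStokesRegularity.FluidComputer.BorderedEigenpairApproxInverse

open Finset CertifierApproxInverse
open scoped InnerProductSpace ComplexConjugate

/-! ## §4a The product `ℓ²`-norm on the bordered coordinate space -/

section Coord

variable {𝕜 : Type*} [RCLike 𝕜] {ι : Type*}

/-- A sub-sum of squares is at most the full one: `i₀`-th coordinate against the product norm. -/
theorem norm_sq_le_sum_add {K : Finset ι} (y : (K → 𝕜) × 𝕜) :
    ‖y.2‖ ^ 2 ≤ ∑ j : K, ‖y.1 j‖ ^ 2 + ‖y.2‖ ^ 2 :=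
  le_add_of_nonneg_left (Finset.sum_nonneg fun _ _ => sq_nonneg _)

/-- The product `ℓ²`-norm on the bordered coordinate space: for
`V = WithLp 2 (EuclideanSpace 𝕜 K × 𝕜)`, `‖(c, g)‖² = Σ_j ‖c_j‖² + ‖g‖²`. [folklore] -/
theorem norm_toV_sq {K : Finset ι} (y : (K → 𝕜) × 𝕜) :
    ‖(WithLp.toLp 2 (WithLp.toLp 2 y.1, y.2) : WithLp 2 (EuclideanSpace 𝕜 K × 𝕜))‖ ^ 2 =
      ∑ j : K, ‖y.1 j‖ ^ 2 + ‖y.2‖ ^ 2 := by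
  rw [WithLp.prod_norm_sq_eq_of_L2]
  simp [EuclideanSpace.norm_sq_eq]

/-- `√` form of `norm_toV_sq`. -/
theorem norm_toV {K : Finset ι} (y : (K → 𝕜) × 𝕜) :
    ‖(WithLp.toLp 2 (WithLp.toLp 2 y.1, y.2) : WithLp 2 (EuclideanSpace 𝕜 K × 𝕜))‖ =
      √(∑ j : K, ‖y.1 j‖ ^ 2 + ‖y.2‖ ^ 2) := by
  rw [← norm_toV_sq, Real.sqrt_sq (norm_nonneg _)]

end Coord

/-! ## §4 The bordered coordinate space: `Binv` and its six matrix hypotheses from `X̃`-data -/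

section Bordered

variable {𝕜 : Type*} [RCLike 𝕜] {ι : Type*} [DecidableEq ι]

/-- **The bordered head inverse from approximate-inverse data** (the certifiers' step
`X̃, θ ⇒ α₀, δ_X ⇒ β_B, β_C', g_B, MU2`, e.g. cert3.py `run_row` steps 7–12).
Setting: head `K`, band `nbr`, first-order matrix `a`, diagonal `dg` (= `λ̃ − ℓ_i`), border
`ṽ = vt`, the bordered Galerkin matrix
`𝔅(c, m) = ((dg_i c_i − Σ_{j∈K} a_ij c_j + m ṽ_i)_{i∈K}, Σ_{i∈K} conj(ṽ_i) c_i)`,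
the outer coupling `(B e)_i = Σ_{j ∈ nbr i ∖ K} a_ij e_j` (`i ∈ K`), the inner coupling
`(C z)_i = Σ_{j∈K} a_ij z_j` measured on the rows `Kc ⊇ K_out := (⋃_{i∈K} nbr i) ∖ K`, shell `sh ⊇
K_out` with real weights `w_i`, and a linear `X` (the float inverse) on `(K → 𝕜) × 𝕜` with, in
the `ℓ²`-product norm: `‖y − X(𝔅 y)‖ ≤ θ‖y‖` (`θ < 1`), `‖X‖ ≤ nX`, `‖X(−B e, 0)‖ ≤ yB ‖e‖_{K_out}`,
`‖B e‖ ≤ nB ‖e‖_{K_out}`, `‖C (X y)₁‖_{Kc} ≤ yC ‖y‖`, `‖C z‖_{Kc} ≤ nC ‖z‖`, `‖(X y)₂‖ ≤ xmu ‖y‖`,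
`‖(X(B e, 0))₂‖ ≤ ygB ‖e‖_{K_out}`, `‖ṽ‖_{Kc} ≤ nt`, and the shell inequality with constant `MU2X`
whose cross term runs through `(X(B e, 0))₁`. CONCLUSION: a linear `Binv` with
`Binv ∘ 𝔅 = 1` and the six hypotheses `hBinv, hαM, hβBM, hβCM, hgBM, hshellM` of
`BorderedEigenpairFromSections.certified_eigenpair_of_sections_nested` LITERALLY, with
`α = nX/(1−θ)`, `δ = αθ`, `β_B = yB + nB δ`, `β_C = yC + nC δ + nt (xmu + δ)`, `g_B = ygB + nB δ`,
`MU2 = MU2X − nB nC δ`. All squared forms as the consumers state them. [folklore] -/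
theorem exists_borderedInverse_of_approx
    (K : Finset ι) (nbr : ι → Finset ι) (Kc sh : Finset ι)
    (hKc : K.biUnion nbr \ K ⊆ Kc) (hKsh : K.biUnion nbr \ K ⊆ sh)
    (a : ι → ι → 𝕜) (dg : ι → 𝕜) (vt : ι → 𝕜) (w : ι → ℝ)
    (X : ((K → 𝕜) × 𝕜) →ₗ[𝕜] ((K → 𝕜) × 𝕜))
    {θ nX yB nB yC nC xmu ygB nt MU2X : ℝ}
    (hθ0 : 0 ≤ θ) (hθ1 : θ < 1) (hnX0 : 0 ≤ nX) (hyB0 : 0 ≤ yB) (hnB0 : 0 ≤ nB)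
    (hyC0 : 0 ≤ yC) (hnC0 : 0 ≤ nC) (hxmu0 : 0 ≤ xmu) (hygB0 : 0 ≤ ygB) (hnt0 : 0 ≤ nt)
    (hθ : ∀ (c : K → 𝕜) (m : 𝕜),
      ∑ j : K, ‖c j - (X (fun i : K => dg i * c i - ∑ j : K, a i j * c j + m * vt i,
          ∑ i : K, conj (vt i) * c i)).1 j‖ ^ 2 +
        ‖m - (X (fun i : K => dg i * c i - ∑ j : K, a i j * c j + m * vt i,
          ∑ i : K, conj (vt i) * c i)).2‖ ^ 2 ≤
        θ ^ 2 * (∑ j : K, ‖c j‖ ^ 2 + ‖m‖ ^ 2))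
    (hnX : ∀ (c : K → 𝕜) (g : 𝕜),
      ∑ j : K, ‖(X (c, g)).1 j‖ ^ 2 + ‖(X (c, g)).2‖ ^ 2 ≤
        nX ^ 2 * (∑ j : K, ‖c j‖ ^ 2 + ‖g‖ ^ 2))
    (hyB : ∀ e : ι → 𝕜,
      ∑ j : K, ‖(X (fun i : K => -∑ j ∈ nbr i \ K, a i j * e j, 0)).1 j‖ ^ 2 +
        ‖(X (fun i : K => -∑ j ∈ nbr i \ K, a i j * e j, 0)).2‖ ^ 2 ≤
        yB ^ 2 * ∑ j ∈ K.biUnion nbr \ K, ‖e j‖ ^ 2)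
    (hnB : ∀ e : ι → 𝕜,
      ∑ i : K, ‖∑ j ∈ nbr i \ K, a i j * e j‖ ^ 2 ≤ nB ^ 2 * ∑ j ∈ K.biUnion nbr \ K, ‖e j‖ ^ 2)
    (hyC : ∀ (c : K → 𝕜) (g : 𝕜),
      ∑ i ∈ Kc, ‖∑ j : K, a i j * (X (c, g)).1 j‖ ^ 2 ≤ yC ^ 2 * (∑ j : K, ‖c j‖ ^ 2 + ‖g‖ ^ 2))
    (hnC : ∀ z : K → 𝕜, ∑ i ∈ Kc, ‖∑ j : K, a i j * z j‖ ^ 2 ≤ nC ^ 2 * ∑ j : K, ‖z j‖ ^ 2)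
    (hxmu : ∀ (c : K → 𝕜) (g : 𝕜),
      ‖(X (c, g)).2‖ ^ 2 ≤ xmu ^ 2 * (∑ j : K, ‖c j‖ ^ 2 + ‖g‖ ^ 2))
    (hygB : ∀ e : ι → 𝕜,
      ‖(X (fun i : K => ∑ j ∈ nbr i \ K, a i j * e j, 0)).2‖ ^ 2 ≤
        ygB ^ 2 * ∑ j ∈ K.biUnion nbr \ K, ‖e j‖ ^ 2)
    (hntc : ∑ i ∈ Kc, ‖vt i‖ ^ 2 ≤ nt ^ 2)
    (hshellX : ∀ e : ι → 𝕜, (∀ i ∈ K, e i = 0) →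
      MU2X * ∑ i ∈ sh, ‖e i‖ ^ 2 ≤ ∑ i ∈ sh, w i * ‖e i‖ ^ 2 -
        RCLike.re (∑ i ∈ K.biUnion nbr \ K,
          conj (∑ j : K, a i j * (X (fun i : K => ∑ j ∈ nbr i \ K, a i j * e j, 0)).1 j) * e i))
    {α δ βB βC gB MU2 : ℝ} (hαdef : α = nX / (1 - θ)) (hδdef : δ = α * θ)
    (hβBdef : βB = yB + nB * δ) (hβCdef : βC = yC + nC * δ + nt * (xmu + δ))
    (hgBdef : gB = ygB + nB * δ) (hMU2def : MU2 = MU2X - nB * nC * δ) :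
    ∃ Binv : ((K → 𝕜) × 𝕜) →ₗ[𝕜] ((K → 𝕜) × 𝕜),
      (∀ (c : K → 𝕜) (m : 𝕜),
        Binv (fun i : K => dg i * c i - ∑ j : K, a i j * c j + m * vt i,
          ∑ i : K, conj (vt i) * c i) = (c, m)) ∧
      (∀ (c : K → 𝕜) (g : 𝕜),
        ∑ j : K, ‖(Binv (c, g)).1 j‖ ^ 2 + ‖(Binv (c, g)).2‖ ^ 2 ≤
          α ^ 2 * (∑ i : K, ‖c i‖ ^ 2 + ‖g‖ ^ 2)) ∧
      (∀ e : ι → 𝕜,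
        ∑ j : K, ‖(Binv (fun i : K => -∑ j ∈ nbr i \ K, a i j * e j, 0)).1 j‖ ^ 2 +
          ‖(Binv (fun i : K => -∑ j ∈ nbr i \ K, a i j * e j, 0)).2‖ ^ 2 ≤
          βB ^ 2 * ∑ j ∈ K.biUnion nbr \ K, ‖e j‖ ^ 2) ∧
      (∀ (c : K → 𝕜) (g : 𝕜),
        ∑ i ∈ Kc, ‖-∑ j : K, a i j * (Binv (c, g)).1 j + (Binv (c, g)).2 * vt i‖ ^ 2 ≤
          βC ^ 2 * (∑ i : K, ‖c i‖ ^ 2 + ‖g‖ ^ 2)) ∧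
      (∀ e : ι → 𝕜,
        ‖(Binv (fun i : K => ∑ j ∈ nbr i \ K, a i j * e j, 0)).2‖ ^ 2 ≤
          gB ^ 2 * ∑ j ∈ K.biUnion nbr \ K, ‖e j‖ ^ 2) ∧
      (∀ e : ι → 𝕜, (∀ i ∈ K, e i = 0) →
        MU2 * ∑ i ∈ sh, ‖e i‖ ^ 2 ≤ ∑ i ∈ sh, w i * ‖e i‖ ^ 2 -
          RCLike.re (∑ i ∈ K.biUnion nbr \ K,
            conj (∑ j : K, a i j * (Binv (fun i : K => ∑ j ∈ nbr i \ K, a i j * e j, 0)).1 j) *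
              e i)) := by
  -- the transport maps to the `ℓ²`-normed copy `V = WithLp 2 (EuclideanSpace 𝕜 K × 𝕜)`
  let toV : ((K → 𝕜) × 𝕜) →ₗ[𝕜] WithLp 2 (EuclideanSpace 𝕜 K × 𝕜) :=
    { toFun := fun y => WithLp.toLp 2 (WithLp.toLp 2 y.1, y.2)
      map_add' := fun _ _ => rfl
      map_smul' := fun _ _ => rfl }
  let ofV : WithLp 2 (EuclideanSpace 𝕜 K × 𝕜) →ₗ[𝕜] ((K → 𝕜) × 𝕜) :=
    { toFun := fun v => (WithLp.ofLp (WithLp.ofLp v).1, (WithLp.ofLp v).2)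
      map_add' := fun _ _ => rfl
      map_smul' := fun _ _ => rfl }
  have h_ot : ∀ y, ofV (toV y) = y := fun _ => rfl
  have h_to : ∀ v, toV (ofV v) = v := fun _ => rfl
  have hN2 : ∀ y : (K → 𝕜) × 𝕜, ‖toV y‖ ^ 2 = ∑ j : K, ‖y.1 j‖ ^ 2 + ‖y.2‖ ^ 2 :=
    fun y => norm_toV_sq y
  have hN : ∀ y : (K → 𝕜) × 𝕜, ‖toV y‖ = √(∑ j : K, ‖y.1 j‖ ^ 2 + ‖y.2‖ ^ 2) :=
    fun y => norm_toV y
  -- the bordered matrix as a linear map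
  let Bo : ((K → 𝕜) × 𝕜) →ₗ[𝕜] ((K → 𝕜) × 𝕜) :=
    { toFun := fun y => (fun i : K => dg i * y.1 i - ∑ j : K, a i j * y.1 j + y.2 * vt i,
        ∑ i : K, conj (vt i) * y.1 i)
      map_add' := fun y z => by
        refine Prod.ext (funext fun i => ?_) ?_
        · simp only [Prod.fst_add, Prod.snd_add, Pi.add_apply, mul_add, add_mul,
            Finset.sum_add_distrib]
          ring
        · simp only [Prod.fst_add, Prod.snd_add, Pi.add_apply, mul_add, Finset.sum_add_distrib]
      map_smul' := fun r y => by
        refine Prod.ext (funext fun i => ?_) ?_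
        · simp only [Prod.smul_fst, Prod.smul_snd, Pi.smul_apply, smul_eq_mul, RingHom.id_apply]
          have hs : ∑ j : K, a i j * (r * y.1 j) = r * ∑ j : K, a i j * y.1 j := by
            rw [Finset.mul_sum]; exact Finset.sum_congr rfl fun j _ => by ring
          rw [hs]; ring
        · simp only [Prod.smul_fst, Prod.smul_snd, Pi.smul_apply, smul_eq_mul, RingHom.id_apply]
          rw [Finset.mul_sum]; exact Finset.sum_congr rfl fun j _ => by ring }
  have hBo : ∀ y, Bo y = (fun i : K => dg i * y.1 i - ∑ j : K, a i j * y.1 j + y.2 * vt i,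
      ∑ i : K, conj (vt i) * y.1 i) := fun y => rfl
  -- §1 applied on `V`
  obtain ⟨Binv', h1, h2, h3, h4⟩ := exists_inverse_of_approx (𝕜 := 𝕜)
    (toV ∘ₗ Bo ∘ₗ ofV) (toV ∘ₗ X ∘ₗ ofV) hθ1 (fun v => by
      set y := ofV v with hy
      have hv : v = toV y := (h_to v).symm
      have key : v - (toV ∘ₗ X ∘ₗ ofV) ((toV ∘ₗ Bo ∘ₗ ofV) v) = toV (y - X (Bo y)) := by
        rw [map_sub, ← hv]
        simp only [LinearMap.coe_comp, Function.comp_apply, ← hy, h_ot]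
      rw [key, hv, hN, hN]
      exact sqrt_le_mul_sqrt hθ0 (hθ y.1 y.2))
  set Binv : ((K → 𝕜) × 𝕜) →ₗ[𝕜] ((K → 𝕜) × 𝕜) := ofV ∘ₗ Binv' ∘ₗ toV with hBinv_def
  have hBapp : ∀ y, Binv y = ofV (Binv' (toV y)) := fun y => rfl
  have htoVB : ∀ y, toV (Binv y) = Binv' (toV y) := fun y => by rw [hBapp, h_to]
  have hX' : ∀ y, (toV ∘ₗ X ∘ₗ ofV) (toV y) = toV (X y) := fun y => by
    simp only [LinearMap.coe_comp, Function.comp_apply, h_ot]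
  have hnX' : ∀ y, ‖toV (X y)‖ ≤ nX * ‖toV y‖ := fun y => by
    rw [hN, hN]; exact sqrt_le_mul_sqrt hnX0 (hnX y.1 y.2)
  have h1θ : 0 < 1 - θ := by linarith
  have hαB : ∀ y, ‖toV (Binv y)‖ ≤ α * ‖toV y‖ := fun y => by
    have h := h3 (toV y)
    rw [hX', ← htoVB] at h
    rw [hαdef, div_mul_eq_mul_div, le_div_iff₀ h1θ]
    calc ‖toV (Binv y)‖ * (1 - θ) = (1 - θ) * ‖toV (Binv y)‖ := mul_comm _ _
      _ ≤ ‖toV (X y)‖ := h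
      _ ≤ nX * ‖toV y‖ := hnX' y
  have hα0 : 0 ≤ α := by rw [hαdef]; positivity
  have hδB : ∀ y, ‖toV (Binv y - X y)‖ ≤ δ * ‖toV y‖ := fun y => by
    have h := h4 (toV y)
    rw [hX', ← htoVB, ← map_sub] at h
    rw [hδdef]
    calc ‖toV (Binv y - X y)‖ ≤ θ * ‖toV (Binv y)‖ := h
      _ ≤ θ * (α * ‖toV y‖) := mul_le_mul_of_nonneg_left (hαB y) hθ0
      _ = α * θ * ‖toV y‖ := by ring
  have hδ0 : 0 ≤ δ := by rw [hδdef]; positivity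
  -- component and coordinate norms against the product norm
  have hsnd : ∀ y : (K → 𝕜) × 𝕜, ‖y.2‖ ≤ ‖toV y‖ := fun y => by
    rw [hN]
    calc ‖y.2‖ = √(‖y.2‖ ^ 2) := (Real.sqrt_sq (norm_nonneg _)).symm
      _ ≤ _ := Real.sqrt_le_sqrt (norm_sq_le_sum_add y)
  have hfst : ∀ y : (K → 𝕜) × 𝕜, √(∑ j : K, ‖y.1 j‖ ^ 2) ≤ ‖toV y‖ := fun y => by
    rw [hN]; exact Real.sqrt_le_sqrt (le_add_of_nonneg_right (sq_nonneg _))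
  -- the outer coupling vectors `(±B e, 0)`
  have hBe : ∀ e : ι → 𝕜,
      ‖toV (fun i : K => ∑ j ∈ nbr i \ K, a i j * e j, (0 : 𝕜))‖ ≤
        nB * √(∑ j ∈ K.biUnion nbr \ K, ‖e j‖ ^ 2) := fun e => by
    refine norm_le_mul_sqrt hnB0 ?_
    rw [hN2]; simpa using hnB e
  have hBe' : ∀ e : ι → 𝕜,
      ‖toV (fun i : K => -∑ j ∈ nbr i \ K, a i j * e j, (0 : 𝕜))‖ ≤
        nB * √(∑ j ∈ K.biUnion nbr \ K, ‖e j‖ ^ 2) := fun e => by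
    refine norm_le_mul_sqrt hnB0 ?_
    rw [hN2]; simpa using hnB e
  refine ⟨Binv, fun c m => ?_, fun c g => ?_, fun e => ?_, fun c g => ?_, fun e => ?_,
    fun e he => ?_⟩
  · -- (O1) left inverse
    have h := h1 (toV (c, m))
    simp only [LinearMap.coe_comp, Function.comp_apply, h_ot] at h
    have : Binv (Bo (c, m)) = (c, m) := by rw [hBapp, h, h_ot]
    exact this
  · -- (O2) `α`
    have h := hαB (c, g)
    rw [hN (c, g)] at h
    have h2 := norm_sq_le_of_le_mul_sqrt (B := ∑ i : K, ‖c i‖ ^ 2 + ‖g‖ ^ 2) (by positivity) h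
    rw [hN2] at h2
    exact h2
  · -- (O3) `β_B`
    set y : (K → 𝕜) × 𝕜 := (fun i : K => -∑ j ∈ nbr i \ K, a i j * e j, 0) with hy
    set E := ∑ j ∈ K.biUnion nbr \ K, ‖e j‖ ^ 2 with hE
    have hE0 : 0 ≤ E := Finset.sum_nonneg fun _ _ => sq_nonneg _
    have hXy : ‖toV (X y)‖ ≤ yB * √E := norm_le_mul_sqrt hyB0 (by rw [hN2]; exact hyB e)
    have hmain : ‖toV (Binv y)‖ ≤ βB * √E := by
      have hsplit : toV (Binv y) = toV (X y) + toV (Binv y - X y) := by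
        rw [← map_add, add_sub_cancel]
      calc ‖toV (Binv y)‖ ≤ ‖toV (X y)‖ + ‖toV (Binv y - X y)‖ := by
            rw [hsplit]; exact norm_add_le _ _
        _ ≤ yB * √E + δ * ‖toV y‖ := add_le_add hXy (hδB y)
        _ ≤ yB * √E + δ * (nB * √E) := by gcongr; exact hBe' e
        _ = βB * √E := by rw [hβBdef]; ring
    rw [← hN2]
    exact norm_sq_le_of_le_mul_sqrt hE0 hmain
  · -- (O4) `β_C'`
    set b := Binv (c, g) with hb
    set x := X (c, g) with hx
    set N2 := ∑ i : K, ‖c i‖ ^ 2 + ‖g‖ ^ 2 with hN2def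
    have hN20 : 0 ≤ N2 := by positivity
    have hNy : ‖toV (c, g)‖ = √N2 := by rw [hN]
    have hbx : ‖toV (b - x)‖ ≤ δ * √N2 := by rw [← hNy]; exact hδB (c, g)
    have hCx : √(∑ i ∈ Kc, ‖∑ j : K, a i j * x.1 j‖ ^ 2) ≤ yC * √N2 :=
      sqrt_le_mul_sqrt hyC0 (hyC c g)
    have hd1 : √(∑ j : K, ‖b.1 j - x.1 j‖ ^ 2) ≤ ‖toV (b - x)‖ := hfst (b - x)
    have hCd : √(∑ i ∈ Kc, ‖∑ j : K, a i j * (b.1 j - x.1 j)‖ ^ 2) ≤ nC * (δ * √N2) :=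
      (sqrt_le_mul_sqrt hnC0 (hnC fun j => b.1 j - x.1 j)).trans
        (mul_le_mul_of_nonneg_left (hd1.trans hbx) hnC0)
    have hCsplit : ∀ i, ∑ j : K, a i j * b.1 j =
        ∑ j : K, a i j * x.1 j + ∑ j : K, a i j * (b.1 j - x.1 j) := fun i => by
      rw [← Finset.sum_add_distrib]; exact Finset.sum_congr rfl fun j _ => by ring
    have hC : √(∑ i ∈ Kc, ‖∑ j : K, a i j * b.1 j‖ ^ 2) ≤ yC * √N2 + nC * (δ * √N2) := by
      calc √(∑ i ∈ Kc, ‖∑ j : K, a i j * b.1 j‖ ^ 2)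
          = √(∑ i ∈ Kc, ‖∑ j : K, a i j * x.1 j + ∑ j : K, a i j * (b.1 j - x.1 j)‖ ^ 2) := by
            simp_rw [hCsplit]
        _ ≤ _ := sqrt_sum_norm_add_sq_le Kc _ _
        _ ≤ yC * √N2 + nC * (δ * √N2) := add_le_add hCx hCd
    have hb2 : ‖b.2‖ ≤ (xmu + δ) * √N2 := by
      have hx2 : ‖x.2‖ ≤ xmu * √N2 := norm_le_mul_sqrt hxmu0 (hxmu c g)
      have hd2 : ‖(b - x).2‖ ≤ ‖toV (b - x)‖ := hsnd (b - x)
      have hsplit : b.2 = x.2 + (b - x).2 := by rw [Prod.snd_sub, add_sub_cancel]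
      calc ‖b.2‖ ≤ ‖x.2‖ + ‖(b - x).2‖ := by rw [hsplit]; exact norm_add_le _ _
        _ ≤ xmu * √N2 + δ * √N2 := add_le_add hx2 (hd2.trans hbx)
        _ = (xmu + δ) * √N2 := by ring
    have hV : √(∑ i ∈ Kc, ‖b.2 * vt i‖ ^ 2) ≤ (xmu + δ) * √N2 * nt := by
      rw [sqrt_sum_norm_mul_sq]
      have hvt : √(∑ i ∈ Kc, ‖vt i‖ ^ 2) ≤ nt :=
        (Real.sqrt_le_sqrt hntc).trans_eq (Real.sqrt_sq hnt0)
      exact mul_le_mul hb2 hvt (Real.sqrt_nonneg _) (by positivity)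
    have htot : √(∑ i ∈ Kc, ‖-∑ j : K, a i j * b.1 j + b.2 * vt i‖ ^ 2) ≤ βC * √N2 := by
      have hneg : √(∑ i ∈ Kc, ‖-∑ j : K, a i j * b.1 j‖ ^ 2) =
          √(∑ i ∈ Kc, ‖∑ j : K, a i j * b.1 j‖ ^ 2) := by simp_rw [norm_neg]
      calc √(∑ i ∈ Kc, ‖-∑ j : K, a i j * b.1 j + b.2 * vt i‖ ^ 2)
          ≤ √(∑ i ∈ Kc, ‖-∑ j : K, a i j * b.1 j‖ ^ 2) + √(∑ i ∈ Kc, ‖b.2 * vt i‖ ^ 2) :=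
            sqrt_sum_norm_add_sq_le Kc _ _
        _ ≤ (yC * √N2 + nC * (δ * √N2)) + (xmu + δ) * √N2 * nt := by
            rw [hneg]; exact add_le_add hC hV
        _ = βC * √N2 := by rw [hβCdef]; ring
    exact le_mul_of_sqrt_le (by positivity) hN20 htot
  · -- (O5) `g_B`
    set y : (K → 𝕜) × 𝕜 := (fun i : K => ∑ j ∈ nbr i \ K, a i j * e j, 0) with hy
    set E := ∑ j ∈ K.biUnion nbr \ K, ‖e j‖ ^ 2 with hE
    have hE0 : 0 ≤ E := Finset.sum_nonneg fun _ _ => sq_nonneg _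
    have hXy2 : ‖(X y).2‖ ≤ ygB * √E := norm_le_mul_sqrt hygB0 (hygB e)
    have hmain : ‖(Binv y).2‖ ≤ gB * √E := by
      have hsplit : (Binv y).2 = (X y).2 + (Binv y - X y).2 := by
        rw [Prod.snd_sub, add_sub_cancel]
      calc ‖(Binv y).2‖ ≤ ‖(X y).2‖ + ‖(Binv y - X y).2‖ := by
            rw [hsplit]; exact norm_add_le _ _
        _ ≤ ygB * √E + δ * ‖toV y‖ := add_le_add hXy2 ((hsnd _).trans (hδB y))
        _ ≤ ygB * √E + δ * (nB * √E) := by gcongr; exact hBe e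
        _ = gB * √E := by rw [hgBdef]; ring
    exact norm_sq_le_of_le_mul_sqrt hE0 hmain
  · -- (O6) the shell inequality through `Binv` (Weyl correction `nB nC δ`)
    set y : (K → 𝕜) × 𝕜 := (fun i : K => ∑ j ∈ nbr i \ K, a i j * e j, 0) with hy
    set E := ∑ j ∈ K.biUnion nbr \ K, ‖e j‖ ^ 2 with hE
    set Ssh := ∑ i ∈ sh, ‖e i‖ ^ 2 with hSsh
    have hE0 : 0 ≤ E := Finset.sum_nonneg fun _ _ => sq_nonneg _
    have hES : E ≤ Ssh :=
      Finset.sum_le_sum_of_subset_of_nonneg hKsh fun _ _ _ => sq_nonneg _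
    set D := Binv y - X y with hD
    have hCsplit : ∀ i, ∑ j : K, a i j * (Binv y).1 j =
        ∑ j : K, a i j * (X y).1 j + ∑ j : K, a i j * D.1 j := fun i => by
      rw [← Finset.sum_add_distrib]
      exact Finset.sum_congr rfl fun j _ => by rw [hD, Prod.fst_sub, Pi.sub_apply]; ring
    have hsum : ∑ i ∈ K.biUnion nbr \ K, conj (∑ j : K, a i j * (Binv y).1 j) * e i =
        ∑ i ∈ K.biUnion nbr \ K, conj (∑ j : K, a i j * (X y).1 j) * e i +
          ∑ i ∈ K.biUnion nbr \ K, conj (∑ j : K, a i j * D.1 j) * e i := by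
      rw [← Finset.sum_add_distrib]
      exact Finset.sum_congr rfl fun i _ => by rw [hCsplit, map_add, add_mul]
    have hcross : RCLike.re (∑ i ∈ K.biUnion nbr \ K, conj (∑ j : K, a i j * D.1 j) * e i) ≤
        nB * nC * δ * Ssh := by
      have h1 := re_sum_conj_mul_le (K.biUnion nbr \ K) (fun i => ∑ j : K, a i j * D.1 j) e
      have h2 : √(∑ i ∈ K.biUnion nbr \ K, ‖∑ j : K, a i j * D.1 j‖ ^ 2) ≤
          nC * (δ * (nB * √E)) := by
        calc √(∑ i ∈ K.biUnion nbr \ K, ‖∑ j : K, a i j * D.1 j‖ ^ 2)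
            ≤ √(∑ i ∈ Kc, ‖∑ j : K, a i j * D.1 j‖ ^ 2) := Real.sqrt_le_sqrt
              (Finset.sum_le_sum_of_subset_of_nonneg hKc fun _ _ _ => sq_nonneg _)
          _ ≤ nC * √(∑ j : K, ‖D.1 j‖ ^ 2) := sqrt_le_mul_sqrt hnC0 (hnC D.1)
          _ ≤ nC * ‖toV D‖ := mul_le_mul_of_nonneg_left (hfst D) hnC0
          _ ≤ nC * (δ * ‖toV y‖) := mul_le_mul_of_nonneg_left (hδB y) hnC0
          _ ≤ nC * (δ * (nB * √E)) := by gcongr; exact hBe e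
      calc RCLike.re (∑ i ∈ K.biUnion nbr \ K, conj (∑ j : K, a i j * D.1 j) * e i)
          ≤ √(∑ i ∈ K.biUnion nbr \ K, ‖∑ j : K, a i j * D.1 j‖ ^ 2) * √E := h1
        _ ≤ nC * (δ * (nB * √E)) * √E := by gcongr
        _ = nB * nC * δ * (√E * √E) := by ring
        _ = nB * nC * δ * E := by rw [Real.mul_self_sqrt hE0]
        _ ≤ nB * nC * δ * Ssh := by gcongr
    have hX := hshellX e he
    rw [hsum, map_add, hMU2def, sub_mul]
    linarith

end Bordered

end Summit.NavierStokesRegularity.FluidComputer.BorderedEigenpairApproxInverse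

end
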